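import Literature.NumberTheory.EllipticCurves.ComplexMultiplicationDeuringLocalPlaces
import Literature.NumberTheory.EllipticCurves.ComplexMultiplicationTwistIsogenyProofs
import Literature.NumberTheory.EllipticCurves.ComplexMultiplicationLocalFactorsAux
import Literature.NumberTheory.EllipticCurves.ComplexMultiplicationBurungaleFlachCorOneProofs
import Mathlib.NumberTheory.NumberField.Discriminant.Different
import Mathlib.NumberTheory.RamificationInertia.Valuation
import Mathlib.Tactic.NormNum.Prime
import HarnessLib

/-!
# Deuring's theorem at the ramified primes: the local factors are `1` (proved for `j ≠ 1728`)

Sibling proof file of `Literature.NumberTheory.EllipticCurves.ComplexMultiplicationDeuringLocalPlaces`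
(D-0014 append protocol; everything here is proved, no definitions). That file reduced
Deuring's `L(E_K/K, s) = L(E/ℚ, s)²` (Silverman, *Advanced Topics*, II Thm. 10.5) to two
statements `hI` (inert primes) and `hR` (ramified primes) about Mathlib's local Euler factors of
an elliptic `W/ℚ` with `W.j ∈ maximalCMJInvariants` and of its base change to the CM field `K`.
This file attacks `hR`: at a place `w` of `K` with ramification index `e(w|p) = 2`,

  `L_w(E_K) = 1` and `L_p(E) = 1`,

i.e. `E` has additive reduction at the ramified prime `p` of `K` and so has `E_K` at `w`
(Silverman, *Advanced Topics*, Ex. 2.31(a), 2.32(a),(b), Thm. 9.2(b)). The proof is the explicit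
one (no Grössencharacter): `p` divides the discriminant of `K` (Mathlib's
`NumberField.not_dvd_discr_iff_forall_mem`), which is the CM discriminant
`d_K ∈ {-3, -4, -7, -8, -11, -19, -43, -67, -163}`; `W` is `ℚ`-isomorphic to an explicit
`p`-integral equation `M` — a quadratic twist of the minimal CM curve of Silverman's table
(App. A §3) for `j ≠ 0, 1728`, `y² = x³ + B` for `j = 0` — with `ord_p Δ(M) ≡ 3 (mod 6)` (resp.
odd) and `3 ord_p c₄(M) ≥ ord_p Δ(M)`, so that `M` (hence `W`) has additive reduction at `p` by
Silverman *AEC* VII.5.1(c) in the valuation form of the tree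
(`hasAdditiveReductionAt_of_valuation_Δ_of_cube_le`: `12 ∤ ord Δ`, `|c₄|³ ≤ |Δ|`), and likewise
over `K` at `w`, where all valuations are squared (`e = 2`: `ord_w = 2 ord_p`, and `12 ∤ 2n`
because `6 ∤ n`).

## Contents (all proved)

* `WeierstrassCurve.localEulerFactor_eq_one_of_integral_model` — the engine: if `C • W = M` with
  `M` `p`-integral, `|Δ(M)|_p = exp(-n)`, `6 ∤ n`, `|c₄(M)|_p³ ≤ |Δ(M)|_p`, and `e(w|p) = 2`, then
  both local Euler factors (of `W_K` at `w`, of `W` at `p`) are `1`.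
* `natGenerator_dvd_discr_of_ramificationIdx_eq_two` — `e(w|p) = 2 ⇒ p ∣ disc K`; with the
  tree's `IsCMFieldOfJ.discr_eq` (`disc K = d_K`, `ComplexMultiplicationBurungaleFlachCorOneProofs`)
  the ramified prime divides `d_K` (`natGenerator_dvd_cmFieldDiscr_of_ramificationIdx_eq_two`).
* `localEulerFactor_eq_one_of_twist_family` — the families `j ≠ 0, 1728` (every curve with
  `j(W) = j(E₀)` is a twist `E₀^{(D)}`, `D ∈ ℤ`, Silverman *AEC* X.5.4), with the data of the
  six minimal CM curves `cm7, …, cm163` (`Δ = -p³`, `p ∣ c₄`) and of `cm8` (`Δ = 2⁹`,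
  `c₄ = 2⁵·5`); `localEulerFactor_eq_one_of_j_eq_zero` — `j = 0` at `p = 3` (`y² = x³ + B`).
* `Deuring_localEulerFactor_ramified_of_j_ne_1728` — **the ramified statement `hR` for all
  `j ∈ maximalCMJInvariants ∖ {1728}`, proved**; and
  `Deuring_localEulerFactor_baseChange_cmField_of_inert_of_j1728`,
  `Deuring_LFunction_baseChange_cmField_of_inert_of_j1728`: Deuring's theorem from the inert
  statement `hI` and the single remaining ramified case `j = 1728` (`y² = x³ + Ax` at `2`, over
  `ℚ` and over `ℚ₂(i)`: there `ord₂ Δ = 6 + 3 ord₂ A` can be `≡ 0 (mod 12)` and a genuine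
  minimality argument at `2` is needed, cf. `CongruentNumberCurveMinimalAtTwo`).

## References

* J. H. Silverman, *Advanced Topics in the Arithmetic of Elliptic Curves*, GTM 151 (1994),
  Ch. II Exercises 2.31(a), 2.32 (PDF p. 179); App. A §3. [SilvermanATAEC1994]
* J. H. Silverman, *The Arithmetic of Elliptic Curves*, 2nd ed. (2009), VII.5 Prop. 5.1(c),
  VII.1 Rem. 1.1, §C.16. [SilvermanAEC2009]
-/

noncomputable section

open scoped Classical

open IsDedekindDomain NumberField Rat.HeightOneSpectrum

namespace WeierstrassCurve

/-! ### Valuations along a quadratic ramified place -/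

section Ramified

variable (K : Type*) [Field K] [NumberField K] (w : HeightOneSpectrum (𝓞 K))

/-- At a place `w` of a number field `K` with ramification index `e(w|p) = 2` over the place
`v = w ∩ ℤ` of `ℚ`, `|x|_w = |x|_v²` for `x ∈ ℚ` (Mathlib `valuation_liesOver`:
`|x|_w = |x|_v^{e}`). [folklore] -/
theorem valuation_algebraMap_of_ramificationIdx_eq_two (he : w.asIdeal.ramificationIdx (𝓞 ℚ) = 2)
    (x : ℚ) :
    w.valuation K (algebraMap ℚ K x) = (w.under (𝓞 ℚ)).valuation ℚ x ^ 2 := by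
  set v := w.under (𝓞 ℚ) with hv
  haveI : w.asIdeal.LiesOver v.asIdeal := ⟨rfl⟩
  have he' : Ideal.ramificationIdx' v.asIdeal w.asIdeal = 2 := by
    rw [Ideal.ramificationIdx'_eq_ramificationIdx v.asIdeal w.asIdeal v.ne_bot]
    exact he
  rw [← he']
  exact (HeightOneSpectrum.valuation_liesOver K v w x).symm

end Ramified

/-! ### The engine: an integral model with `6 ∤ ord Δ`, `3 ord c₄ ≥ ord Δ` at a ramified prime -/

section Engine

variable (K : Type) [Field K] [NumberField K] (w : HeightOneSpectrum (𝓞 K))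

/-- **Both local Euler factors are `1` from an integral model.** Let `W/ℚ` be elliptic and
`C • W = M` a `ℚ`-isomorphic equation whose coefficients are integral at the place `v = w ∩ ℤ`
below a place `w` of `K` of ramification index `2`, with `|Δ(M)|_v = exp(-n)`, `6 ∤ n` and
`|c₄(M)|_v³ ≤ |Δ(M)|_v` (i.e. `ord_v(j) ≥ 0`). Then `M`, hence `W`, has additive reduction at `v`
(Silverman *AEC* VII.5.1(c) via `hasAdditiveReductionAt_of_valuation_Δ_of_cube_le`, as
`12 ∤ n`), and `M_K`, hence `W_K`, has additive reduction at `w` (all valuations are squared,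
`valuation_algebraMap_of_ramificationIdx_eq_two`, and `12 ∤ 2n`); so the local Euler factors of
`W_K` at `w` and of `W` at `v` are both `1` (`localEulerFactor_eq_one_of_hasAdditiveReductionAt`,
`localEulerFactor_smul`). [cite: SilvermanAEC2009, VII.5 Prop. 5.1(c) and §C.16] -/
theorem localEulerFactor_eq_one_of_integral_model (W M : WeierstrassCurve ℚ) [W.IsElliptic]
    (C : VariableChange ℚ) (hWM : C • W = M) (he : w.asIdeal.ramificationIdx (𝓞 ℚ) = 2)
    (h₁ : (w.under (𝓞 ℚ)).valuation ℚ M.a₁ ≤ 1) (h₂ : (w.under (𝓞 ℚ)).valuation ℚ M.a₂ ≤ 1)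
    (h₃ : (w.under (𝓞 ℚ)).valuation ℚ M.a₃ ≤ 1) (h₄ : (w.under (𝓞 ℚ)).valuation ℚ M.a₄ ≤ 1)
    (h₆ : (w.under (𝓞 ℚ)).valuation ℚ M.a₆ ≤ 1) {n : ℕ}
    (hΔ : (w.under (𝓞 ℚ)).valuation ℚ M.Δ = WithZero.exp (-(n : ℤ))) (hn : ¬ 6 ∣ n)
    (hc₄ : (w.under (𝓞 ℚ)).valuation ℚ M.c₄ ^ 3 ≤ (w.under (𝓞 ℚ)).valuation ℚ M.Δ) :
    ((W.baseChange K).baseChange (w.adicCompletion K)).localEulerFactor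
        (w.adicCompletionIntegers K) = 1 ∧
      (W.baseChange ((w.under (𝓞 ℚ)).adicCompletion ℚ)).localEulerFactor
        ((w.under (𝓞 ℚ)).adicCompletionIntegers ℚ) = 1 := by
  set v := w.under (𝓞 ℚ) with hv
  haveI hM : M.IsElliptic := by rw [← hWM]; infer_instance
  -- over `ℚ`
  have haddQ : M.HasAdditiveReductionAt v :=
    hasAdditiveReductionAt_of_valuation_Δ_of_cube_le v M h₁ h₂ h₃ h₄ h₆ hΔ
      (fun h12 ↦ hn (Nat.dvd_trans (by norm_num) h12)) hc₄
  have hLQ : (M.baseChange (v.adicCompletion ℚ)).localEulerFactor (v.adicCompletionIntegers ℚ) =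
      1 := Literature.NumberTheory.EllipticCurves.localEulerFactor_eq_one_of_hasAdditiveReductionAt v M haddQ
  -- over `K`
  have hval : ∀ x : ℚ, w.valuation K (algebraMap ℚ K x) = v.valuation ℚ x ^ 2 :=
    valuation_algebraMap_of_ramificationIdx_eq_two K w he
  have hK₁ : w.valuation K (M.baseChange K).a₁ ≤ 1 := by
    simp only [baseChange, map_a₁, hval]; exact pow_le_one' h₁ 2
  have hK₂ : w.valuation K (M.baseChange K).a₂ ≤ 1 := by
    simp only [baseChange, map_a₂, hval]; exact pow_le_one' h₂ 2
  have hK₃ : w.valuation K (M.baseChange K).a₃ ≤ 1 := by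
    simp only [baseChange, map_a₃, hval]; exact pow_le_one' h₃ 2
  have hK₄ : w.valuation K (M.baseChange K).a₄ ≤ 1 := by
    simp only [baseChange, map_a₄, hval]; exact pow_le_one' h₄ 2
  have hK₆ : w.valuation K (M.baseChange K).a₆ ≤ 1 := by
    simp only [baseChange, map_a₆, hval]; exact pow_le_one' h₆ 2
  have hKΔ : w.valuation K (M.baseChange K).Δ = WithZero.exp (-((2 * n : ℕ) : ℤ)) := by
    rw [baseChange, map_Δ, hval, hΔ, ← WithZero.exp_nsmul]
    congr 1
    push_cast
    ring
  have hKc₄ : w.valuation K (M.baseChange K).c₄ ^ 3 ≤ w.valuation K (M.baseChange K).Δ := by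
    rw [baseChange, map_c₄, map_Δ, hval, hval]
    calc (v.valuation ℚ M.c₄ ^ 2) ^ 3 = (v.valuation ℚ M.c₄ ^ 3) ^ 2 := by
          rw [← pow_mul, ← pow_mul, mul_comm]
      _ ≤ v.valuation ℚ M.Δ ^ 2 := pow_le_pow_left' hc₄ 2
  have haddK : (M.baseChange K).HasAdditiveReductionAt w :=
    hasAdditiveReductionAt_of_valuation_Δ_of_cube_le w (M.baseChange K) hK₁ hK₂ hK₃ hK₄ hK₆ hKΔ
      (fun h12 ↦ hn (by omega)) hKc₄
  have hLK : ((M.baseChange K).baseChange (w.adicCompletion K)).localEulerFactor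
      (w.adicCompletionIntegers K) = 1 :=
    Literature.NumberTheory.EllipticCurves.localEulerFactor_eq_one_of_hasAdditiveReductionAt w (M.baseChange K) haddK
  -- transfer along `C • W = M`
  haveI : (W.baseChange (v.adicCompletion ℚ)).IsElliptic := by rw [baseChange]; infer_instance
  haveI : ((W.baseChange K).baseChange (w.adicCompletion K)).IsElliptic := by
    rw [baseChange, baseChange, map_map]; infer_instance
  constructor
  · rw [← hWM] at hLK
    simpa only [baseChange, ← map_variableChange, localEulerFactor_smul] using hLK
  · rw [← hWM] at hLQ
    simpa only [baseChange, ← map_variableChange, localEulerFactor_smul] using hLQ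

end Engine

end WeierstrassCurve

namespace Literature.NumberTheory.EllipticCurves

open WeierstrassCurve

/-! ### The ramified prime divides the discriminant -/

/-- **A prime of ramification index `2` lies over a prime dividing the discriminant**
(Dedekind's discriminant theorem, the direction in Mathlib:
`NumberField.not_dvd_discr_iff_forall_mem` — if `p ∤ disc K` then every prime of `𝓞 K` above
`p` is unramified over `ℤ`, hence over `𝓞 ℚ` (`Algebra.IsUnramifiedAt.of_restrictScalars`), and
so has ramification index `1`, `Ideal.ramificationIdx_eq_one`). [folklore] -/
theorem natGenerator_dvd_discr_of_ramificationIdx_eq_two (K : Type*) [Field K] [NumberField K]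
    (w : HeightOneSpectrum (𝓞 K)) (he : w.asIdeal.ramificationIdx (𝓞 ℚ) = 2) :
    (natGenerator (w.under (𝓞 ℚ)) : ℤ) ∣ NumberField.discr K := by
  set v := w.under (𝓞 ℚ) with hv
  by_contra hnd
  have hp : Prime (natGenerator v : ℤ) := Rat.prime_natGenerator_int v
  have hunr := (NumberField.not_dvd_discr_iff_forall_mem K (𝓞 K) hp).mp hnd w.asIdeal
    w.isPrime ?_
  · haveI : Algebra.IsUnramifiedAt (𝓞 ℚ) w.asIdeal :=
      Algebra.IsUnramifiedAt.of_restrictScalars (R := ℤ) (A := 𝓞 ℚ) w.asIdeal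
    have h1 : w.asIdeal.ramificationIdx (𝓞 ℚ) = 1 := Ideal.ramificationIdx_eq_one w.asIdeal (𝓞 ℚ)
    rw [he] at h1
    exact absurd h1 (by norm_num)
  · -- `(p : 𝓞 K) ∈ w`
    have hmem : ((natGenerator v : ℕ) : 𝓞 ℚ) ∈ v.asIdeal :=
      (Literature.NumberTheory.GaloisRepresentations.Rat.natCast_mem_asIdeal_iff v).mpr dvd_rfl
    have hmem' : algebraMap (𝓞 ℚ) (𝓞 K) ((natGenerator v : ℕ) : 𝓞 ℚ) ∈ w.asIdeal :=
      Ideal.mem_comap.mp hmem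
    rw [map_natCast] at hmem'
    exact_mod_cast hmem'

/-! ### The ramified prime is the prime dividing `d_K` -/

/-- For `W` with `W.j ∈ maximalCMJInvariants` and `K` its CM field, a place of `K` of
ramification index `2` lies over a prime dividing `d_K = cmFieldDiscr W.j`
(`natGenerator_dvd_discr_of_ramificationIdx_eq_two` and the tree's `IsCMFieldOfJ.discr_eq`,
`disc K = d_K`, `ComplexMultiplicationBurungaleFlachCorOneProofs`). [folklore] -/
theorem natGenerator_dvd_cmFieldDiscr_of_ramificationIdx_eq_two {j : ℚ}
    (hj : j ∈ maximalCMJInvariants) (K : Type*) [Field K] [NumberField K] (hK : IsCMFieldOfJ K j)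
    (w : HeightOneSpectrum (𝓞 K)) (he : w.asIdeal.ramificationIdx (𝓞 ℚ) = 2) :
    (natGenerator (w.under (𝓞 ℚ)) : ℤ) ∣ cmFieldDiscr j := by
  rw [← hK.discr_eq hj]
  exact natGenerator_dvd_discr_of_ramificationIdx_eq_two K w he

/-- If the prime under `v` divides `±q` for a rational prime `q`, it is `q`. [folklore] -/
theorem natGenerator_eq_of_dvd_neg (v : HeightOneSpectrum (𝓞 ℚ)) {q : ℕ} (hq : q.Prime)
    (h : (natGenerator v : ℤ) ∣ -(q : ℤ)) : natGenerator v = q :=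
  Rat.natGenerator_eq_of_dvd v hq (by exact_mod_cast (Int.dvd_neg.mp h))

/-! ### Integer bookkeeping -/

/-- `D = p^a · D₀` with `p ∤ D₀`, for a nonzero integer `D` and a prime `p`. [folklore] -/
theorem Int.exists_eq_pow_mul_not_dvd {p : ℕ} (hp : p.Prime) {D : ℤ} (hD : D ≠ 0) :
    ∃ (a : ℕ) (D₀ : ℤ), D = (p : ℤ) ^ a * D₀ ∧ ¬ (p : ℤ) ∣ D₀ := by
  obtain ⟨a, n', hn', hD'⟩ :=
    Nat.exists_eq_pow_mul_and_not_dvd (Int.natAbs_ne_zero.mpr hD) p hp.ne_one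
  refine ⟨a, D.sign * n', ?_, fun h ↦ hn' ?_⟩
  · calc D = D.sign * (D.natAbs : ℤ) := (Int.sign_mul_natAbs D).symm
      _ = D.sign * ((p : ℤ) ^ a * n') := by rw [hD']; push_cast; ring
      _ = (p : ℤ) ^ a * (D.sign * n') := by ring
  · have h' := Int.ofNat_dvd_left.mp h
    rwa [Int.natAbs_mul, Int.natAbs_sign_of_ne_zero hD, one_mul, Int.natAbs_natCast] at h'

/-- The valuation at `v` of a nonzero integer is `exp (-a)` where `p_v^a ∥ D`. [folklore] -/
theorem Rat.exists_valuation_intCast_eq (v : HeightOneSpectrum (𝓞 ℚ)) {D : ℤ} (hD : D ≠ 0) :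
    ∃ a : ℕ, v.valuation ℚ (D : ℚ) = WithZero.exp (-(a : ℤ)) := by
  obtain ⟨a, D₀, rfl, hD₀⟩ := Int.exists_eq_pow_mul_not_dvd (prime_natGenerator v) hD
  refine ⟨a, ?_⟩
  push_cast
  exact WeierstrassCurve.Rat.valuation_pow_mul_intCast v hD₀ a

/-! ### The families `j ≠ 0, 1728`: quadratic twists of a fixed model -/

section TwistFamily

variable (K : Type) [Field K] [NumberField K] (w : HeightOneSpectrum (𝓞 K))

/-- **Both local factors are `1` for every curve with the `j`-invariant of a model `E₀` whose
twists are integral at `p` with `6 ∤ ord_p Δ(E₀)` and `ord_p j(E₀) ≥ 0`.** Let `E₀/ℚ` be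
elliptic with `j(E₀) ≠ 0, 1728`, `w` a place of `K` of ramification index `2` over
`v = w ∩ ℤ`, and suppose: every quadratic twist `E₀^{(D)}`, `D ∈ ℤ`, has `v`-integral
coefficients; `|Δ(E₀)|_v = exp(-k)` with `6 ∤ k`; `|c₄(E₀)|_v³ ≤ |Δ(E₀)|_v`. Then for every
elliptic `W/ℚ` with `j(W) = j(E₀)` both local Euler factors (of `W_K` at `w`, of `W` at `v`)
are `1`: `W ≅ E₀^{(d)}` (Silverman *AEC* X.5.4, `exists_variableChange_eq_quadraticTwist_of_j_eq'`)
`≅ E₀^{(D)}` with `D = d · den(d)² ∈ ℤ` (`exists_variableChange_quadraticTwist_mul_sq`),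
`Δ(E₀^{(D)}) = D⁶ Δ(E₀)`, `c₄(E₀^{(D)}) = D² c₄(E₀)`, so `ord_v Δ = 6 ord_v D + k` with
`6 ∤`, and the engine `localEulerFactor_eq_one_of_integral_model` applies.
[cite: SilvermanAEC2009, X.5 Prop. 5.4 with VII.5 Prop. 5.1(c)] -/
theorem localEulerFactor_eq_one_of_twist_family (E₀ : WeierstrassCurve ℚ) [E₀.IsElliptic]
    (h0 : E₀.j ≠ 0) (h1728 : E₀.j ≠ 1728) (W : WeierstrassCurve ℚ) [W.IsElliptic]
    (hjW : W.j = E₀.j) (he : w.asIdeal.ramificationIdx (𝓞 ℚ) = 2)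
    (hint : ∀ D : ℤ, (w.under (𝓞 ℚ)).valuation ℚ (E₀.quadraticTwist (D : ℚ)).a₂ ≤ 1 ∧
      (w.under (𝓞 ℚ)).valuation ℚ (E₀.quadraticTwist (D : ℚ)).a₄ ≤ 1 ∧
        (w.under (𝓞 ℚ)).valuation ℚ (E₀.quadraticTwist (D : ℚ)).a₆ ≤ 1)
    {k : ℕ} (hΔ₀ : (w.under (𝓞 ℚ)).valuation ℚ E₀.Δ = WithZero.exp (-(k : ℤ))) (hk : ¬ 6 ∣ k)
    (hc₄₀ : (w.under (𝓞 ℚ)).valuation ℚ E₀.c₄ ^ 3 ≤ (w.under (𝓞 ℚ)).valuation ℚ E₀.Δ) :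
    ((W.baseChange K).baseChange (w.adicCompletion K)).localEulerFactor
        (w.adicCompletionIntegers K) = 1 ∧
      (W.baseChange ((w.under (𝓞 ℚ)).adicCompletion ℚ)).localEulerFactor
        ((w.under (𝓞 ℚ)).adicCompletionIntegers ℚ) = 1 := by
  set v := w.under (𝓞 ℚ) with hv
  -- `W ≅ E₀^{(d)} ≅ E₀^{(D)}`, `D = num(d) den(d) ∈ ℤ`
  obtain ⟨d, hd, C, hC⟩ := exists_variableChange_eq_quadraticTwist_of_j_eq' hjW (hjW ▸ h0)
    (hjW ▸ h1728)
  have hden : (d.den : ℚ) ≠ 0 := by exact_mod_cast d.den_nz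
  obtain ⟨C', hC'⟩ := E₀.exists_variableChange_quadraticTwist_mul_sq d d.den hden
  set D : ℤ := d.num * d.den with hD_def
  have hdD : d * (d.den : ℚ) ^ 2 = (D : ℚ) := by
    rw [hD_def, Int.cast_mul, Int.cast_natCast, ← Rat.mul_den_eq_num d]
    ring
  have hD0 : D ≠ 0 := mul_ne_zero (Rat.num_ne_zero.mpr hd) (by exact_mod_cast d.den_nz)
  have hWM : (C' * C) • W = E₀.quadraticTwist (D : ℚ) := by
    rw [mul_smul, hC, hC', hdD]
  -- valuations of the twist
  obtain ⟨a, ha⟩ := Rat.exists_valuation_intCast_eq v hD0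
  obtain ⟨h₂, h₄, h₆⟩ := hint D
  have hΔ : v.valuation ℚ (E₀.quadraticTwist (D : ℚ)).Δ = WithZero.exp (-((6 * a + k : ℕ) : ℤ)) := by
    rw [quadraticTwist_Δ, Valuation.map_mul, Valuation.map_pow, ha, hΔ₀, ← WithZero.exp_nsmul,
      ← WithZero.exp_add]
    congr 1
    push_cast
    ring
  have hc₄ : v.valuation ℚ (E₀.quadraticTwist (D : ℚ)).c₄ ^ 3 ≤
      v.valuation ℚ (E₀.quadraticTwist (D : ℚ)).Δ := by
    rw [quadraticTwist_c₄, quadraticTwist_Δ, Valuation.map_mul, Valuation.map_mul,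
      Valuation.map_pow, Valuation.map_pow, mul_pow, ← pow_mul]
    exact mul_le_mul_right hc₄₀ _
  exact localEulerFactor_eq_one_of_integral_model K w W _ (C' * C) hWM he
    (by rw [quadraticTwist_a₁, Valuation.map_zero]; exact zero_le)
    h₂ (by rw [quadraticTwist_a₃, Valuation.map_zero]; exact zero_le) h₄ h₆ hΔ (by omega) hc₄

/-- Integrality of the twist coefficients `D b₂/4`, `D² b₄/2`, `D³ b₆/4` at an odd prime, for
a model `E₀` with integral `b₂, b₄, b₆`. [folklore] -/
theorem valuation_quadraticTwist_le_one_of_odd (E₀ : WeierstrassCurve ℚ) {B₂ B₄ B₆ : ℤ}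
    (hb₂ : E₀.b₂ = B₂) (hb₄ : E₀.b₄ = B₄) (hb₆ : E₀.b₆ = B₆) (v : HeightOneSpectrum (𝓞 ℚ))
    (hp2 : natGenerator v ≠ 2) (D : ℤ) :
    v.valuation ℚ (E₀.quadraticTwist (D : ℚ)).a₂ ≤ 1 ∧
      v.valuation ℚ (E₀.quadraticTwist (D : ℚ)).a₄ ≤ 1 ∧
        v.valuation ℚ (E₀.quadraticTwist (D : ℚ)).a₆ ≤ 1 := by
  have h2 : ¬ (natGenerator v : ℤ) ∣ 2 := fun h ↦
    hp2 (Rat.natGenerator_eq_of_dvd v Nat.prime_two (by exact_mod_cast h))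
  have h4 : ¬ (natGenerator v : ℤ) ∣ 4 := fun h ↦ by
    have h' : (natGenerator v : ℤ) ∣ 2 * 2 := by norm_num at h ⊢; exact h
    rcases (Rat.prime_natGenerator_int v).dvd_or_dvd h' with h'' | h'' <;> exact h2 h''
  have hv2 : v.valuation ℚ (2 : ℚ) = 1 := by
    exact_mod_cast Literature.NumberTheory.GaloisRepresentations.Rat.valuation_intCast_eq_one v h2
  have hv4 : v.valuation ℚ (4 : ℚ) = 1 := by
    exact_mod_cast Literature.NumberTheory.GaloisRepresentations.Rat.valuation_intCast_eq_one v h4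
  have hD : v.valuation ℚ (D : ℚ) ≤ 1 := Rat.valuation_intCast_le_one v D
  refine ⟨?_, ?_, ?_⟩
  · rw [quadraticTwist_a₂, hb₂, Valuation.map_div, Valuation.map_mul, hv4, div_one]
    exact mul_le_one' hD (Rat.valuation_intCast_le_one v B₂)
  · rw [quadraticTwist_a₄, hb₄, Valuation.map_div, Valuation.map_mul, Valuation.map_pow, hv2,
      div_one]
    exact mul_le_one' (pow_le_one' hD 2) (Rat.valuation_intCast_le_one v B₄)
  · rw [quadraticTwist_a₆, hb₆, Valuation.map_div, Valuation.map_mul, Valuation.map_pow, hv4,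
      div_one]
    exact mul_le_one' (pow_le_one' hD 3) (Rat.valuation_intCast_le_one v B₆)

/-- The data `|Δ(E₀)|_p = exp(-3)`, `|c₄(E₀)|_p³ ≤ |Δ(E₀)|_p` for a model with `Δ(E₀) = -p³`
and `p ∣ c₄(E₀)` (the six minimal CM curves of Silverman's table, App. A §3). [folklore] -/
theorem valuation_data_of_Δ_eq_neg_cube (E₀ : WeierstrassCurve ℚ) (v : HeightOneSpectrum (𝓞 ℚ))
    {c' : ℤ} (hΔ : E₀.Δ = -((natGenerator v : ℚ) ^ 3))
    (hc₄ : E₀.c₄ = (natGenerator v : ℚ) * c') :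
    v.valuation ℚ E₀.Δ = WithZero.exp (-((3 : ℕ) : ℤ)) ∧
      v.valuation ℚ E₀.c₄ ^ 3 ≤ v.valuation ℚ E₀.Δ := by
  have hvp := Literature.NumberTheory.GaloisRepresentations.Rat.valuation_natGenerator v
  have hΔv : v.valuation ℚ E₀.Δ = WithZero.exp (-((3 : ℕ) : ℤ)) := by
    rw [hΔ, Valuation.map_neg, Valuation.map_pow, hvp, ← WithZero.exp_nsmul]
    norm_num
  refine ⟨hΔv, ?_⟩
  rw [hΔv, hc₄, Valuation.map_mul, hvp, mul_pow, ← WithZero.exp_nsmul]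
  calc WithZero.exp (3 • (-1 : ℤ)) * v.valuation ℚ (c' : ℚ) ^ 3
      ≤ WithZero.exp (3 • (-1 : ℤ)) * 1 :=
        mul_le_mul_right (pow_le_one' (Rat.valuation_intCast_le_one v c') 3) _
    _ = WithZero.exp (-((3 : ℕ) : ℤ)) := by rw [mul_one]; norm_num

end TwistFamily

/-! ### The family `j = 0`: `y² = x³ + B` at `p = 3` -/

section JZero

variable (K : Type) [Field K] [NumberField K] (w : HeightOneSpectrum (𝓞 K))

/-- **`j = 0`: both local factors are `1` at the place above `3`** (the ramified prime of
`ℚ(√-3)`). An elliptic `W/ℚ` with `j(W) = 0` is `ℚ`-isomorphic to `y² = x³ + B` with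
`B ∈ ℤ ∖ {0}` (short Weierstrass form, `c₄ = 0`, rescaled by `den(B)`), for which
`Δ = -2⁴3³B²` has `ord₃ Δ = 3 + 2 ord₃ B` odd and `c₄ = 0`; so the engine applies at the place
`v` over `3` below a place `w` with `e(w|v) = 2`.
[cite: SilvermanAEC2009, VII.5 Prop. 5.1(c) (with X.5.4(iii) for the twists of j = 0)] -/
theorem localEulerFactor_eq_one_of_j_eq_zero (W : WeierstrassCurve ℚ) [W.IsElliptic]
    (hj : W.j = 0) (he : w.asIdeal.ramificationIdx (𝓞 ℚ) = 2)
    (hp : natGenerator (w.under (𝓞 ℚ)) = 3) :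
    ((W.baseChange K).baseChange (w.adicCompletion K)).localEulerFactor
        (w.adicCompletionIntegers K) = 1 ∧
      (W.baseChange ((w.under (𝓞 ℚ)).adicCompletion ℚ)).localEulerFactor
        ((w.under (𝓞 ℚ)).adicCompletionIntegers ℚ) = 1 := by
  set v := w.under (𝓞 ℚ) with hv
  -- a short model `S = C • W : y² = x³ + B`, `B ≠ 0`
  obtain ⟨C, hC⟩ := W.exists_variableChange_isShortNF
  haveI := hC
  have hjS : (C • W).j = 0 := by rw [variableChange_j]; exact hj
  have hden := four_mul_a₄_cube_add_ne_zero (C • W)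
  have hA : (C • W).a₄ = 0 := by
    have hj' := (C • W).j_of_isShortNF
    rw [hjS, eq_comm, div_eq_zero_iff] at hj'
    rcases hj' with h | h
    · exact pow_eq_zero_iff (n := 3) (by norm_num) |>.mp (by linarith [h])
    · exact absurd h hden
  set B : ℚ := (C • W).a₆ with hB_def
  have hB : B ≠ 0 := by
    intro hB
    apply hden
    rw [hA, hB]; ring
  have hS : C • W = ⟨0, 0, 0, 0, B⟩ := by
    ext
    · exact a₁_of_isShortNF _
    · exact a₂_of_isShortNF _
    · exact a₃_of_isShortNF _
    · exact hA
    · rfl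
  -- rescale to an integral `B' = num(B) den(B)⁵`
  set u : ℚ := (B.den : ℚ)⁻¹ with hu_def
  have hu : u ≠ 0 := inv_ne_zero (by exact_mod_cast B.den_nz)
  set B' : ℤ := B.num * B.den ^ 5 with hB'_def
  have hBB' : (B.den : ℚ) ^ 6 * B = (B' : ℚ) := by
    rw [hB'_def, Int.cast_mul, Int.cast_pow, Int.cast_natCast, ← Rat.mul_den_eq_num B]
    ring
  have hB'0 : B' ≠ 0 := mul_ne_zero (Rat.num_ne_zero.mpr hB) (pow_ne_zero _ (by exact_mod_cast B.den_nz))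
  set M : WeierstrassCurve ℚ := ⟨0, 0, 0, 0, (B' : ℚ)⟩ with hM_def
  have hWM : ((⟨Units.mk0 u hu, 0, 0, 0⟩ : VariableChange ℚ) * C) • W = M := by
    rw [mul_smul, hS, hM_def]
    ext
    · simp [variableChange_a₁]
    · simp [variableChange_a₂]
    · simp [variableChange_a₃]
    · simp [variableChange_a₄]
    · simp only [variableChange_a₆, Units.val_inv_eq_inv_val, Units.val_mk0, hu_def, inv_inv,
        mul_zero, add_zero, sub_zero, ← hBB']
      ring
  -- valuations at `v`, `p_v = 3`
  obtain ⟨a, ha⟩ := Rat.exists_valuation_intCast_eq v hB'0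
  have h3 : v.valuation ℚ (3 : ℚ) = WithZero.exp (-1 : ℤ) := by
    have := Literature.NumberTheory.GaloisRepresentations.Rat.valuation_natGenerator v
    rwa [hp] at this
  have h16 : v.valuation ℚ (16 : ℚ) = 1 := by
    have h : ¬ (natGenerator v : ℤ) ∣ 16 := by rw [hp]; norm_num
    exact_mod_cast Literature.NumberTheory.GaloisRepresentations.Rat.valuation_intCast_eq_one v h
  have hΔM : M.Δ = -(16 * 3 ^ 3 * (B' : ℚ) ^ 2) := by
    simp only [hM_def, Δ, b₂, b₄, b₆, b₈]; ring
  have hΔ : v.valuation ℚ M.Δ = WithZero.exp (-((2 * a + 3 : ℕ) : ℤ)) := by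
    rw [hΔM, Valuation.map_neg, Valuation.map_mul, Valuation.map_mul, Valuation.map_pow,
      Valuation.map_pow, h16, h3, ha, one_mul, ← WithZero.exp_nsmul, ← WithZero.exp_nsmul,
      ← WithZero.exp_add]
    congr 1
    push_cast
    ring
  have hc₄M : M.c₄ = 0 := by simp only [hM_def, c₄, b₂, b₄]; ring
  refine localEulerFactor_eq_one_of_integral_model K w W M _ hWM he ?_ ?_ ?_ ?_ ?_ hΔ (by omega) ?_
  · simp only [hM_def, Valuation.map_zero]; exact zero_le
  · simp only [hM_def, Valuation.map_zero]; exact zero_le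
  · simp only [hM_def, Valuation.map_zero]; exact zero_le
  · simp only [hM_def, Valuation.map_zero]; exact zero_le
  · exact Rat.valuation_intCast_le_one v B'
  · rw [hc₄M, Valuation.map_zero, zero_pow three_ne_zero]; exact zero_le

end JZero

/-! ### The seven families `j ≠ 0, 1728`: per-curve data and both local factors -/

section Families

variable (K : Type) [Field K] [NumberField K] (w : HeightOneSpectrum (𝓞 K))

/-- **`j = -3375` (`d_K = -7`): both local factors are `1` at the place above `7`**,
from the minimal CM curve `cm7` of Silverman's table (App. A §3): `Δ = -7³`,
`c₄ = 7 · 15`, integral `b₂, b₄, b₆ = -3, -4, -4`.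
[cite: SilvermanATAEC1994, App. A §3 (second table, row D = -7)] -/
theorem localEulerFactor_eq_one_of_j_eq_cm7 (W : WeierstrassCurve ℚ) [W.IsElliptic]
    (hj : W.j = -3375) (he : w.asIdeal.ramificationIdx (𝓞 ℚ) = 2)
    (hp : natGenerator (w.under (𝓞 ℚ)) = 7) :
    ((W.baseChange K).baseChange (w.adicCompletion K)).localEulerFactor
        (w.adicCompletionIntegers K) = 1 ∧
      (W.baseChange ((w.under (𝓞 ℚ)).adicCompletion ℚ)).localEulerFactor
        ((w.under (𝓞 ℚ)).adicCompletionIntegers ℚ) = 1 := by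
  set v := w.under (𝓞 ℚ) with hv
  have hp2 : natGenerator v ≠ 2 := by rw [hp]; norm_num
  obtain ⟨hΔ₀, hc₄₀⟩ := valuation_data_of_Δ_eq_neg_cube cm7 v (c' := 15)
    (by rw [hp, Δ_cm7]; push_cast; ring)
    (by rw [hp]; norm_num [cm7, WeierstrassCurve.c₄, WeierstrassCurve.b₂, WeierstrassCurve.b₄])
  exact localEulerFactor_eq_one_of_twist_family K w cm7 (by rw [j_cm7]; norm_num)
    (by rw [j_cm7]; norm_num) W (by rw [hj, j_cm7]) he
    (valuation_quadraticTwist_le_one_of_odd cm7 (B₂ := -3) (B₄ := -4) (B₆ := -4)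
      (by norm_num [cm7, WeierstrassCurve.b₂]) (by norm_num [cm7, WeierstrassCurve.b₄])
      (by norm_num [cm7, WeierstrassCurve.b₆]) v hp2)
    hΔ₀ (by norm_num) hc₄₀

/-- **`j = -32768` (`d_K = -11`): both local factors are `1` at the place above `11`**,
from the minimal CM curve `cm11` of Silverman's table (App. A §3): `Δ = -11³`,
`c₄ = 11 · 32`, integral `b₂, b₄, b₆ = -4, -14, 41`.
[cite: SilvermanATAEC1994, App. A §3 (second table, row D = -11)] -/
theorem localEulerFactor_eq_one_of_j_eq_cm11 (W : WeierstrassCurve ℚ) [W.IsElliptic]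
    (hj : W.j = -32768) (he : w.asIdeal.ramificationIdx (𝓞 ℚ) = 2)
    (hp : natGenerator (w.under (𝓞 ℚ)) = 11) :
    ((W.baseChange K).baseChange (w.adicCompletion K)).localEulerFactor
        (w.adicCompletionIntegers K) = 1 ∧
      (W.baseChange ((w.under (𝓞 ℚ)).adicCompletion ℚ)).localEulerFactor
        ((w.under (𝓞 ℚ)).adicCompletionIntegers ℚ) = 1 := by
  set v := w.under (𝓞 ℚ) with hv
  have hp2 : natGenerator v ≠ 2 := by rw [hp]; norm_num
  obtain ⟨hΔ₀, hc₄₀⟩ := valuation_data_of_Δ_eq_neg_cube cm11 v (c' := 32)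
    (by rw [hp, Δ_cm11]; push_cast; ring)
    (by rw [hp]; norm_num [cm11, WeierstrassCurve.c₄, WeierstrassCurve.b₂, WeierstrassCurve.b₄])
  exact localEulerFactor_eq_one_of_twist_family K w cm11 (by rw [j_cm11]; norm_num)
    (by rw [j_cm11]; norm_num) W (by rw [hj, j_cm11]) he
    (valuation_quadraticTwist_le_one_of_odd cm11 (B₂ := -4) (B₄ := -14) (B₆ := 41)
      (by norm_num [cm11, WeierstrassCurve.b₂]) (by norm_num [cm11, WeierstrassCurve.b₄])
      (by norm_num [cm11, WeierstrassCurve.b₆]) v hp2)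
    hΔ₀ (by norm_num) hc₄₀

/-- **`j = -884736` (`d_K = -19`): both local factors are `1` at the place above `19`**,
from the minimal CM curve `cm19` of Silverman's table (App. A §3): `Δ = -19³`,
`c₄ = 19 · 96`, integral `b₂, b₄, b₆ = 0, -76, 361`.
[cite: SilvermanATAEC1994, App. A §3 (second table, row D = -19)] -/
theorem localEulerFactor_eq_one_of_j_eq_cm19 (W : WeierstrassCurve ℚ) [W.IsElliptic]
    (hj : W.j = -884736) (he : w.asIdeal.ramificationIdx (𝓞 ℚ) = 2)
    (hp : natGenerator (w.under (𝓞 ℚ)) = 19) :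
    ((W.baseChange K).baseChange (w.adicCompletion K)).localEulerFactor
        (w.adicCompletionIntegers K) = 1 ∧
      (W.baseChange ((w.under (𝓞 ℚ)).adicCompletion ℚ)).localEulerFactor
        ((w.under (𝓞 ℚ)).adicCompletionIntegers ℚ) = 1 := by
  set v := w.under (𝓞 ℚ) with hv
  have hp2 : natGenerator v ≠ 2 := by rw [hp]; norm_num
  obtain ⟨hΔ₀, hc₄₀⟩ := valuation_data_of_Δ_eq_neg_cube cm19 v (c' := 96)
    (by rw [hp, Δ_cm19]; push_cast; ring)
    (by rw [hp]; norm_num [cm19, WeierstrassCurve.c₄, WeierstrassCurve.b₂, WeierstrassCurve.b₄])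
  exact localEulerFactor_eq_one_of_twist_family K w cm19 (by rw [j_cm19]; norm_num)
    (by rw [j_cm19]; norm_num) W (by rw [hj, j_cm19]) he
    (valuation_quadraticTwist_le_one_of_odd cm19 (B₂ := 0) (B₄ := -76) (B₆ := 361)
      (by norm_num [cm19, WeierstrassCurve.b₂]) (by norm_num [cm19, WeierstrassCurve.b₄])
      (by norm_num [cm19, WeierstrassCurve.b₆]) v hp2)
    hΔ₀ (by norm_num) hc₄₀

/-- **`j = -884736000` (`d_K = -43`): both local factors are `1` at the place above `43`**,
from the minimal CM curve `cm43` of Silverman's table (App. A §3): `Δ = -43³`,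
`c₄ = 43 · 960`, integral `b₂, b₄, b₆ = 0, -1720, 38829`.
[cite: SilvermanATAEC1994, App. A §3 (second table, row D = -43)] -/
theorem localEulerFactor_eq_one_of_j_eq_cm43 (W : WeierstrassCurve ℚ) [W.IsElliptic]
    (hj : W.j = -884736000) (he : w.asIdeal.ramificationIdx (𝓞 ℚ) = 2)
    (hp : natGenerator (w.under (𝓞 ℚ)) = 43) :
    ((W.baseChange K).baseChange (w.adicCompletion K)).localEulerFactor
        (w.adicCompletionIntegers K) = 1 ∧
      (W.baseChange ((w.under (𝓞 ℚ)).adicCompletion ℚ)).localEulerFactor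
        ((w.under (𝓞 ℚ)).adicCompletionIntegers ℚ) = 1 := by
  set v := w.under (𝓞 ℚ) with hv
  have hp2 : natGenerator v ≠ 2 := by rw [hp]; norm_num
  obtain ⟨hΔ₀, hc₄₀⟩ := valuation_data_of_Δ_eq_neg_cube cm43 v (c' := 960)
    (by rw [hp, Δ_cm43]; push_cast; ring)
    (by rw [hp]; norm_num [cm43, WeierstrassCurve.c₄, WeierstrassCurve.b₂, WeierstrassCurve.b₄])
  exact localEulerFactor_eq_one_of_twist_family K w cm43 (by rw [j_cm43]; norm_num)
    (by rw [j_cm43]; norm_num) W (by rw [hj, j_cm43]) he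
    (valuation_quadraticTwist_le_one_of_odd cm43 (B₂ := 0) (B₄ := -1720) (B₆ := 38829)
      (by norm_num [cm43, WeierstrassCurve.b₂]) (by norm_num [cm43, WeierstrassCurve.b₄])
      (by norm_num [cm43, WeierstrassCurve.b₆]) v hp2)
    hΔ₀ (by norm_num) hc₄₀

/-- **`j = -147197952000` (`d_K = -67`): both local factors are `1` at the place above `67`**,
from the minimal CM curve `cm67` of Silverman's table (App. A §3): `Δ = -67³`,
`c₄ = 67 · 5280`, integral `b₂, b₄, b₆ = 0, -14740, 974113`.
[cite: SilvermanATAEC1994, App. A §3 (second table, row D = -67)] -/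
theorem localEulerFactor_eq_one_of_j_eq_cm67 (W : WeierstrassCurve ℚ) [W.IsElliptic]
    (hj : W.j = -147197952000) (he : w.asIdeal.ramificationIdx (𝓞 ℚ) = 2)
    (hp : natGenerator (w.under (𝓞 ℚ)) = 67) :
    ((W.baseChange K).baseChange (w.adicCompletion K)).localEulerFactor
        (w.adicCompletionIntegers K) = 1 ∧
      (W.baseChange ((w.under (𝓞 ℚ)).adicCompletion ℚ)).localEulerFactor
        ((w.under (𝓞 ℚ)).adicCompletionIntegers ℚ) = 1 := by
  set v := w.under (𝓞 ℚ) with hv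
  have hp2 : natGenerator v ≠ 2 := by rw [hp]; norm_num
  obtain ⟨hΔ₀, hc₄₀⟩ := valuation_data_of_Δ_eq_neg_cube cm67 v (c' := 5280)
    (by rw [hp, Δ_cm67]; push_cast; ring)
    (by rw [hp]; norm_num [cm67, WeierstrassCurve.c₄, WeierstrassCurve.b₂, WeierstrassCurve.b₄])
  exact localEulerFactor_eq_one_of_twist_family K w cm67 (by rw [j_cm67]; norm_num)
    (by rw [j_cm67]; norm_num) W (by rw [hj, j_cm67]) he
    (valuation_quadraticTwist_le_one_of_odd cm67 (B₂ := 0) (B₄ := -14740) (B₆ := 974113)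
      (by norm_num [cm67, WeierstrassCurve.b₂]) (by norm_num [cm67, WeierstrassCurve.b₄])
      (by norm_num [cm67, WeierstrassCurve.b₆]) v hp2)
    hΔ₀ (by norm_num) hc₄₀

/-- **`j = -262537412640768000` (`d_K = -163`): both local factors are `1` at the place above `163`**,
from the minimal CM curve `cm163` of Silverman's table (App. A §3): `Δ = -163³`,
`c₄ = 163 · 640320`, integral `b₂, b₄, b₆ = 0, -4348840, 4936546769`.
[cite: SilvermanATAEC1994, App. A §3 (second table, row D = -163)] -/
theorem localEulerFactor_eq_one_of_j_eq_cm163 (W : WeierstrassCurve ℚ) [W.IsElliptic]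
    (hj : W.j = -262537412640768000) (he : w.asIdeal.ramificationIdx (𝓞 ℚ) = 2)
    (hp : natGenerator (w.under (𝓞 ℚ)) = 163) :
    ((W.baseChange K).baseChange (w.adicCompletion K)).localEulerFactor
        (w.adicCompletionIntegers K) = 1 ∧
      (W.baseChange ((w.under (𝓞 ℚ)).adicCompletion ℚ)).localEulerFactor
        ((w.under (𝓞 ℚ)).adicCompletionIntegers ℚ) = 1 := by
  set v := w.under (𝓞 ℚ) with hv
  have hp2 : natGenerator v ≠ 2 := by rw [hp]; norm_num
  obtain ⟨hΔ₀, hc₄₀⟩ := valuation_data_of_Δ_eq_neg_cube cm163 v (c' := 640320)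
    (by rw [hp, Δ_cm163]; push_cast; ring)
    (by rw [hp]; norm_num [cm163, WeierstrassCurve.c₄, WeierstrassCurve.b₂, WeierstrassCurve.b₄])
  exact localEulerFactor_eq_one_of_twist_family K w cm163 (by rw [j_cm163]; norm_num)
    (by rw [j_cm163]; norm_num) W (by rw [hj, j_cm163]) he
    (valuation_quadraticTwist_le_one_of_odd cm163 (B₂ := 0) (B₄ := -4348840) (B₆ := 4936546769)
      (by norm_num [cm163, WeierstrassCurve.b₂]) (by norm_num [cm163, WeierstrassCurve.b₄])
      (by norm_num [cm163, WeierstrassCurve.b₆]) v hp2)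
    hΔ₀ (by norm_num) hc₄₀

/-- **`j = 8000` (`d_K = -8`): both local factors are `1` at the place above `2`**, from
`E₈ : y² = x³ + 4x² + 2x` (Silverman, App. A §3): its twists `E₈^{(D)} = [0, 4D, 0, 2D², 0]` are
integral, `Δ(E₈) = 2⁹` (`6 ∤ 9`), `c₄(E₈) = 2⁵ · 5`.
[cite: SilvermanATAEC1994, App. A §3 (second table, row D = -8)] -/
theorem localEulerFactor_eq_one_of_j_eq_cm8 (W : WeierstrassCurve ℚ) [W.IsElliptic]
    (hj : W.j = 8000) (he : w.asIdeal.ramificationIdx (𝓞 ℚ) = 2)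
    (hp : natGenerator (w.under (𝓞 ℚ)) = 2) :
    ((W.baseChange K).baseChange (w.adicCompletion K)).localEulerFactor
        (w.adicCompletionIntegers K) = 1 ∧
      (W.baseChange ((w.under (𝓞 ℚ)).adicCompletion ℚ)).localEulerFactor
        ((w.under (𝓞 ℚ)).adicCompletionIntegers ℚ) = 1 := by
  set v := w.under (𝓞 ℚ) with hv
  -- the twists are integral: `[0, 4D, 0, 2D², 0]`
  have hint : ∀ D : ℤ, v.valuation ℚ (cm8.quadraticTwist (D : ℚ)).a₂ ≤ 1 ∧
      v.valuation ℚ (cm8.quadraticTwist (D : ℚ)).a₄ ≤ 1 ∧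
        v.valuation ℚ (cm8.quadraticTwist (D : ℚ)).a₆ ≤ 1 := by
    intro D
    have h2 : (cm8.quadraticTwist (D : ℚ)).a₂ = ((4 * D : ℤ) : ℚ) := by
      rw [quadraticTwist_a₂]; norm_num [cm8, WeierstrassCurve.b₂]; ring
    have h4 : (cm8.quadraticTwist (D : ℚ)).a₄ = ((2 * D ^ 2 : ℤ) : ℚ) := by
      rw [quadraticTwist_a₄]; norm_num [cm8, WeierstrassCurve.b₄]; ring
    have h6 : (cm8.quadraticTwist (D : ℚ)).a₆ = ((0 : ℤ) : ℚ) := by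
      rw [quadraticTwist_a₆]; norm_num [cm8, WeierstrassCurve.b₆]
    rw [h2, h4, h6]
    exact ⟨Rat.valuation_intCast_le_one v _, Rat.valuation_intCast_le_one v _,
      Rat.valuation_intCast_le_one v _⟩
  -- `Δ(E₈) = 2⁹`, `c₄(E₈) = 2⁵ · 5`
  have hΔ₀ : v.valuation ℚ cm8.Δ = WithZero.exp (-((9 : ℕ) : ℤ)) := by
    have hΔ : cm8.Δ = (natGenerator v : ℚ) ^ 9 * ((1 : ℤ) : ℚ) := by
      rw [hp]; norm_num [cm8, WeierstrassCurve.Δ, WeierstrassCurve.b₂, WeierstrassCurve.b₄,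
        WeierstrassCurve.b₆, WeierstrassCurve.b₈]
    rw [hΔ]
    exact WeierstrassCurve.Rat.valuation_pow_mul_intCast v (m := 1) (by rw [hp]; norm_num) 9
  have hc₄₀ : v.valuation ℚ cm8.c₄ ^ 3 ≤ v.valuation ℚ cm8.Δ := by
    have hc : cm8.c₄ = ((160 : ℤ) : ℚ) := by
      norm_num [cm8, WeierstrassCurve.c₄, WeierstrassCurve.b₂, WeierstrassCurve.b₄]
    have h160 : (natGenerator v : ℤ) ^ 5 ∣ 160 := by rw [hp]; norm_num
    have hle := Literature.NumberTheory.GaloisRepresentations.Rat.valuation_intCast_le v h160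
    rw [hc, hΔ₀]
    calc v.valuation ℚ ((160 : ℤ) : ℚ) ^ 3 ≤ WithZero.exp (-((5 : ℕ) : ℤ)) ^ 3 :=
          pow_le_pow_left' hle 3
      _ ≤ WithZero.exp (-((9 : ℕ) : ℤ)) := by
          rw [← WithZero.exp_nsmul, WithZero.exp_le_exp]; norm_num
  exact localEulerFactor_eq_one_of_twist_family K w cm8 (by rw [j_cm8]; norm_num)
    (by rw [j_cm8]; norm_num) W (by rw [hj, j_cm8]) he hint hΔ₀ (by norm_num) hc₄₀

end Families

/-! ### Assembly: the ramified leaf for `j ≠ 1728`, and Deuring from the inert leaf + `j = 1728` -/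

/-- **Deuring's theorem at the ramified primes, for `j ≠ 1728` — proved.** For an elliptic
`W/ℚ` with `W.j ∈ maximalCMJInvariants ∖ {1728}`, `K` its CM field and `w` a place of `K` of
ramification index `2`, both local Euler factors (of `W_K` at `w`, of `W` at the prime `p`
below) are `1`: `p` divides `disc K = d_K` (`natGenerator_dvd_cmFieldDiscr_of_ramificationIdx_eq_two`),
so `p = |d_K|` (resp. `p = 2` for `d_K = -8`), and the explicit families apply
(`localEulerFactor_eq_one_of_j_eq_cm7`, …, `…_cm8`, `localEulerFactor_eq_one_of_j_eq_zero`).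
This is the hypothesis `hR` of `Deuring_localEulerFactor_baseChange_cmField_of_inert_of_ramified`
away from `j = 1728` (Silverman, *Advanced Topics*, Ex. 2.31(a), 2.32(a),(b)).
[cite: SilvermanATAEC1994, Ch. II Exercises 2.31(a), 2.32 (PDF p. 179) with App. A §3] -/
theorem Deuring_localEulerFactor_ramified_of_j_ne_1728 (W : WeierstrassCurve ℚ) [W.IsElliptic]
    (hj : W.j ∈ maximalCMJInvariants) (h1728 : W.j ≠ 1728) (K : Type) [Field K] [NumberField K]
    (hK : IsCMFieldOfJ K W.j) (w : HeightOneSpectrum (𝓞 K))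
    (he : w.asIdeal.ramificationIdx (𝓞 ℚ) = 2) :
    ((W.baseChange K).baseChange (w.adicCompletion K)).localEulerFactor
        (w.adicCompletionIntegers K) = 1 ∧
      (W.baseChange ((w.under (𝓞 ℚ)).adicCompletion ℚ)).localEulerFactor
        ((w.under (𝓞 ℚ)).adicCompletionIntegers ℚ) = 1 := by
  set v := w.under (𝓞 ℚ) with hv
  have hpd := natGenerator_dvd_cmFieldDiscr_of_ramificationIdx_eq_two hj K hK w he
  have hjc := hj
  simp only [maximalCMJInvariants, Finset.mem_insert, Finset.mem_singleton] at hjc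
  rcases hjc with hj0 | hj0 | hj0 | hj0 | hj0 | hj0 | hj0 | hj0 | hj0 <;>
    rw [hj0] at hpd <;> norm_num [cmFieldDiscr] at hpd
  · -- `j = 0`, `p = 3`
    exact localEulerFactor_eq_one_of_j_eq_zero K w W hj0 he
      (Rat.natGenerator_eq_of_dvd v Nat.prime_three (by exact_mod_cast hpd))
  · exact absurd hj0 h1728
  · exact localEulerFactor_eq_one_of_j_eq_cm7 K w W hj0 he
      (Rat.natGenerator_eq_of_dvd v (by norm_num) (by exact_mod_cast hpd))
  · -- `j = 8000`, `p ∣ 8`, so `p = 2`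
    have hp : natGenerator v = 2 := by
      have h8 : (natGenerator v : ℤ) ∣ 2 ^ 3 := by norm_num; exact hpd
      exact Rat.natGenerator_eq_of_dvd v Nat.prime_two
        (by exact_mod_cast (Rat.prime_natGenerator_int v).dvd_of_dvd_pow h8)
    exact localEulerFactor_eq_one_of_j_eq_cm8 K w W hj0 he hp
  · exact localEulerFactor_eq_one_of_j_eq_cm11 K w W hj0 he
      (Rat.natGenerator_eq_of_dvd v (by norm_num) (by exact_mod_cast hpd))
  · exact localEulerFactor_eq_one_of_j_eq_cm19 K w W hj0 he
      (Rat.natGenerator_eq_of_dvd v (by norm_num) (by exact_mod_cast hpd))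
  · exact localEulerFactor_eq_one_of_j_eq_cm43 K w W hj0 he
      (Rat.natGenerator_eq_of_dvd v (by norm_num) (by exact_mod_cast hpd))
  · exact localEulerFactor_eq_one_of_j_eq_cm67 K w W hj0 he
      (Rat.natGenerator_eq_of_dvd v (by norm_num) (by exact_mod_cast hpd))
  · exact localEulerFactor_eq_one_of_j_eq_cm163 K w W hj0 he
      (Rat.natGenerator_eq_of_dvd v (by norm_num) (by exact_mod_cast hpd))

/-- **Deuring's theorem prime by prime from the inert leaf and the ramified case at
`j = 1728`.** With the ramified primes settled for `j ≠ 1728`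
(`Deuring_localEulerFactor_ramified_of_j_ne_1728`), the per-prime identity
`Deuring_localEulerFactor_baseChange_cmField` (★ₚ) follows from the inert statement `hI` and
the ramified statement for `j = 1728` alone (`h1728`: for `E : y² = x³ + Ax`, `K = ℚ(i)`, the
place over `2`: `L_w(E_K) = L_2(E) = 1`, i.e. `E` is additive at `2` and stays additive over
`ℚ₂(i)` — Silverman, *Advanced Topics*, Ex. 2.31(a), 2.32 for `j = 1728`).
[cite: SilvermanATAEC1994, Ch. II Exercises 2.30–2.32 (PDF p. 179)] -/
theorem Deuring_localEulerFactor_baseChange_cmField_of_inert_of_j1728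
    (hI : ∀ (W : WeierstrassCurve ℚ) [W.IsElliptic], W.j ∈ maximalCMJInvariants →
      ∀ (K : Type) [Field K] [NumberField K], IsCMFieldOfJ K W.j →
        ∀ w : HeightOneSpectrum (𝓞 K), w.asIdeal.inertiaDeg (𝓞 ℚ) = 2 →
          ((W.baseChange K).baseChange (w.adicCompletion K)).localEulerFactor
              (w.adicCompletionIntegers K) =
            (W.baseChange ((w.under (𝓞 ℚ)).adicCompletion ℚ)).localEulerFactor
              ((w.under (𝓞 ℚ)).adicCompletionIntegers ℚ) ^ 2)
    (h1728 : ∀ (W : WeierstrassCurve ℚ) [W.IsElliptic], W.j = 1728 →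
      ∀ (K : Type) [Field K] [NumberField K], IsCMFieldOfJ K W.j →
        ∀ w : HeightOneSpectrum (𝓞 K), w.asIdeal.ramificationIdx (𝓞 ℚ) = 2 →
          ((W.baseChange K).baseChange (w.adicCompletion K)).localEulerFactor
              (w.adicCompletionIntegers K) = 1 ∧
            (W.baseChange ((w.under (𝓞 ℚ)).adicCompletion ℚ)).localEulerFactor
              ((w.under (𝓞 ℚ)).adicCompletionIntegers ℚ) = 1) :
    Deuring_localEulerFactor_baseChange_cmField := by
  refine Deuring_localEulerFactor_baseChange_cmField_of_inert_of_ramified hI ?_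
  intro W _ hj K _ _ hK w he
  by_cases h : W.j = 1728
  · exact h1728 W h K hK w he
  · exact Deuring_localEulerFactor_ramified_of_j_ne_1728 W hj h K hK w he

/-- **Deuring's `L(E_K/K, s) = L(E/ℚ, s)²` from the inert leaf and the ramified case at
`j = 1728`** (`Deuring_LFunction_baseChange_cmField_of_local` applied to the above).
[cite: SilvermanATAEC1994, Ch. II Thm. 10.5 (a), (b) (PDF p. 171)] -/
theorem Deuring_LFunction_baseChange_cmField_of_inert_of_j1728
    (hI : ∀ (W : WeierstrassCurve ℚ) [W.IsElliptic], W.j ∈ maximalCMJInvariants →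
      ∀ (K : Type) [Field K] [NumberField K], IsCMFieldOfJ K W.j →
        ∀ w : HeightOneSpectrum (𝓞 K), w.asIdeal.inertiaDeg (𝓞 ℚ) = 2 →
          ((W.baseChange K).baseChange (w.adicCompletion K)).localEulerFactor
              (w.adicCompletionIntegers K) =
            (W.baseChange ((w.under (𝓞 ℚ)).adicCompletion ℚ)).localEulerFactor
              ((w.under (𝓞 ℚ)).adicCompletionIntegers ℚ) ^ 2)
    (h1728 : ∀ (W : WeierstrassCurve ℚ) [W.IsElliptic], W.j = 1728 →
      ∀ (K : Type) [Field K] [NumberField K], IsCMFieldOfJ K W.j →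
        ∀ w : HeightOneSpectrum (𝓞 K), w.asIdeal.ramificationIdx (𝓞 ℚ) = 2 →
          ((W.baseChange K).baseChange (w.adicCompletion K)).localEulerFactor
              (w.adicCompletionIntegers K) = 1 ∧
            (W.baseChange ((w.under (𝓞 ℚ)).adicCompletion ℚ)).localEulerFactor
              ((w.under (𝓞 ℚ)).adicCompletionIntegers ℚ) = 1) :
    Deuring_LFunction_baseChange_cmField :=
  Deuring_LFunction_baseChange_cmField_of_local
    (Deuring_localEulerFactor_baseChange_cmField_of_inert_of_j1728 hI h1728)

end Literature.NumberTheory.EllipticCurves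

end
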